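import Literature.Analysis.FunctionSpaces.LpDualityTestFunctions
import HarnessLib

/-!
# From test-function pairings to pointwise bounds almost everywhere

Analysis/FunctionSpaces-style support file (everything proved) for the discharge of the named
fact `Literature.Analysis.FluidPDE.LemarieRieusset2016.step3_velocityBound`
(`CKNMorreyRepresentation.lean`; Lemarié-Rieusset 2016, §13.9 Step 3, (13.52), p. 475:
`|v| ≤ C(𝓘₂|g| + …)` pointwise). The duality proof of (13.52) produces, for the localised
velocity `v` and a majorant `W ≥ 0` (a sum of parabolic Riesz potentials), the tested inequality
`|∫ v Ψ| ≤ ∫ |Ψ| W` for all smooth `Ψ` compactly supported in an open set `S`; this file extracts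
from it the pointwise bound `|v| ≤ W` a.e. on `S`:

* `ofReal_abs_setIntegral_mul_le_of_forall_test_weighted` — extension of the tested inequality
  to bounded measurable `g` vanishing off a compact `K ⊆ S` (mollification: the mollified `g` are
  admissible test functions, converge a.e. to `g` — Mathlib's
  `ContDiffBump.ae_convolution_tendsto_right_of_locallyIntegrable` — and dominated convergence
  on both sides, which is where the local integrability of `W` on `S` enters);
* `ae_enorm_le_of_forall_test` — **the extraction**: if `E ∈ L¹(S)`, `W` is a.e.-measurable
  with `∫_K W < ∞` for compact `K ⊆ S`, and `|∫_S E Ψ| ≤ ∫ |Ψ| W` for all test functions `Ψ`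
  supported in `S`, then `|E| ≤ W` a.e. on `S` (test with `g = 𝟙_T E/|E|` on the sets
  `T = K_k ∩ {W ≤ M} ∩ {W < |E|}`, which must be null).

Everything is stated on a finite-dimensional real normed space with an additive Haar measure.

## References

* H. Brezis, *Functional Analysis, Sobolev Spaces and PDE* (2011), Prop. 4.23 / Cor. 4.24
  (du Bois-Reymond: a locally integrable function orthogonal to `C_c^∞` vanishes a.e.; the same
  mollification mechanism). [folklore]
-/

noncomputable section

open MeasureTheory TopologicalSpace Set Function Filter Topology ContinuousLinearMap Metric
open scoped ENNReal NNReal Convolution Pointwise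

namespace Literature.Analysis.FunctionSpaces

variable {G : Type*} [NormedAddCommGroup G] [NormedSpace ℝ G] [FiniteDimensional ℝ G]
  [MeasurableSpace G] [BorelSpace G] {μ : Measure G} [μ.IsAddHaarMeasure]

/-! ### Extension of the weighted test-function bound to bounded functions -/

/-- **Extension of a weighted test-function bound to bounded functions supported in a compact
subset.** Let `S` be open, `E ∈ L¹(S, μ)`, `W ≥ 0` a.e.-measurable with `∫_{K'} W < ∞` for every
compact `K' ⊆ S`, and suppose `|∫_S E Ψ dμ| ≤ ∫ |Ψ| W dμ` for every smooth compactly supported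
`Ψ` with `tsupport Ψ ⊆ S`. Then the same holds for every strongly measurable `g` with `|g| ≤ C`
vanishing off a compact `K ⊆ S`. [folklore] -/
theorem ofReal_abs_setIntegral_mul_le_of_forall_test_weighted {S : Set G} (hS : IsOpen S)
    {E : G → ℝ} (hE : IntegrableOn E S μ) {W : G → ℝ≥0∞} (hW : AEMeasurable W μ)
    (hWint : ∀ K' : Set G, IsCompact K' → K' ⊆ S → ∫⁻ x in K', W x ∂μ < ∞)
    (h : ∀ Ψ : G → ℝ, ContDiff ℝ (⊤ : ℕ∞) Ψ → HasCompactSupport Ψ → tsupport Ψ ⊆ S →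
      ENNReal.ofReal |∫ x in S, E x * Ψ x ∂μ| ≤ ∫⁻ x, ‖Ψ x‖ₑ * W x ∂μ)
    {K : Set G} (hK : IsCompact K) (hKS : K ⊆ S) {g : G → ℝ} (hgm : StronglyMeasurable g)
    {C : ℝ} (hgC : ∀ x, |g x| ≤ C) (hgK : ∀ x, x ∉ K → g x = 0) :
    ENNReal.ofReal |∫ x in S, E x * g x ∂μ| ≤ ∫⁻ x, ‖g x‖ₑ * W x ∂μ := by
  -- room around `K` inside `S`
  obtain ⟨δ, hδ, hδS⟩ := hK.exists_cthickening_subset_open hS hKS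
  have hK'c : IsCompact (cthickening δ K) := hK.cthickening
  -- the class of `g`
  have hC : 0 ≤ C := (abs_nonneg _).trans (hgC 0)
  have hgc : HasCompactSupport g := HasCompactSupport.intro hK hgK
  have hgam : AEStronglyMeasurable g μ := hgm.aestronglyMeasurable
  have hgsupp : support g ⊆ K := fun x hx => by_contra fun hxK => hx (hgK x hxK)
  have hgn : ∀ x, ‖g x‖ ≤ C := fun x => (Real.norm_eq_abs _).trans_le (hgC x)
  have hgi : Integrable g μ := by
    rw [← integrableOn_iff_integrable_of_support_subset hgsupp]
    exact Measure.integrableOn_of_bounded hK.measure_lt_top.ne hgam (Eventually.of_forall hgn)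
  have hgl : LocallyIntegrable g μ := hgi.locallyIntegrable
  -- the mollifier sequence
  obtain ⟨φ, hφ0, hφ2⟩ := exists_contDiffBump_seq (E := G)
  set gs : ℕ → G → ℝ := fun n => (φ n).normed μ ⋆[lsmul ℝ ℝ, μ] g with hgs
  have hev : ∀ᶠ n in atTop, (φ n).rOut < δ := hφ0.eventually (gt_mem_nhds hδ)
  have hsm : ∀ n, ContDiff ℝ (⊤ : ℕ∞) (gs n) := fun n =>
    (φ n).hasCompactSupport_normed.contDiff_convolution_left _ (φ n).contDiff_normed hgl
  have hcs : ∀ n, HasCompactSupport (gs n) := fun n =>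
    (φ n).hasCompactSupport_normed.convolution _ hgc
  have hsupp : ∀ n, (φ n).rOut ≤ δ → support (gs n) ⊆ cthickening δ K := by
    intro n hn x hx
    have h1 := support_convolution_subset (L := lsmul ℝ ℝ) (μ := μ) (f := (φ n).normed μ)
      (g := g) hx
    rw [(φ n).support_normed_eq] at h1
    obtain ⟨a, ha, b, hb, rfl⟩ := h1
    refine (cthickening_mono hn K) (thickening_subset_cthickening _ _
      (mem_thickening_iff.2 ⟨b, hgsupp hb, ?_⟩))
    rw [dist_eq_norm, add_sub_cancel_right]
    exact mem_ball_zero_iff.1 ha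
  have hts : ∀ n, (φ n).rOut ≤ δ → tsupport (gs n) ⊆ S := fun n hn =>
    (closure_minimal (hsupp n hn) isClosed_cthickening).trans hδS
  have hbd : ∀ n x, |gs n x| ≤ C := by
    intro n x
    have := dist_convolution_le (μ := μ) (x₀ := x) (z₀ := (0 : ℝ)) hC
      (φ n).support_normed_eq.subset (φ n).nonneg_normed (φ n).integral_normed hgam
      (fun y _ => by rw [dist_zero_right]; exact hgn y)
    rwa [Real.dist_eq, sub_zero] at this
  have hzero : ∀ n, (φ n).rOut ≤ δ → ∀ x, x ∉ cthickening δ K → gs n x = 0 := fun n hn x hx => by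
    by_contra hne
    exact hx (hsupp n hn (mem_support.2 hne))
  -- a.e. convergence
  have hae : ∀ᵐ x ∂μ, Tendsto (fun n => gs n x) atTop (𝓝 (g x)) :=
    ContDiffBump.ae_convolution_tendsto_right_of_locallyIntegrable hφ0
      (Eventually.of_forall hφ2) hgl
  -- dominated convergence on the `E` side
  have hlim : Tendsto (fun n => ∫ x in S, E x * gs n x ∂μ) atTop
      (𝓝 (∫ x in S, E x * g x ∂μ)) := by
    refine tendsto_integral_of_dominated_convergence (fun x => C * ‖E x‖)
      (fun n => hE.aestronglyMeasurable.mul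
        (hsm n).continuous.aestronglyMeasurable) (hE.norm.const_mul C) (fun n => ?_) ?_
    · filter_upwards with x
      rw [norm_mul, mul_comm]
      exact mul_le_mul_of_nonneg_right ((Real.norm_eq_abs _).trans_le (hbd n x))
        (norm_nonneg _)
    · exact (ae_restrict_of_ae hae).mono fun x hx => hx.const_mul (E x)
  have hlim' : Tendsto (fun n => ENNReal.ofReal |∫ x in S, E x * gs n x ∂μ|) atTop
      (𝓝 (ENNReal.ofReal |∫ x in S, E x * g x ∂μ|)) :=
    (ENNReal.continuous_ofReal.tendsto _).comp ((continuous_abs.tendsto _).comp hlim)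
  -- dominated convergence on the `W` side
  have hWfin : ∀ᵐ x ∂μ, x ∈ cthickening δ K → W x < ∞ := by
    have h1 : ∀ᵐ x ∂(μ.restrict (cthickening δ K)), W x < ∞ :=
      ae_lt_top' hW.restrict (hWint _ hK'c hδS).ne
    rw [ae_restrict_iff' hK'c.measurableSet] at h1
    exact h1
  obtain ⟨N, hN⟩ := eventually_atTop.1 hev
  have hlimW : Tendsto (fun n => ∫⁻ x, ‖gs n x‖ₑ * W x ∂μ) atTop (𝓝 (∫⁻ x, ‖g x‖ₑ * W x ∂μ)) := by
    set bound : G → ℝ≥0∞ := (cthickening δ K).indicator fun x => ENNReal.ofReal C * W x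
      with hbound
    rw [← tendsto_add_atTop_iff_nat N]
    refine tendsto_lintegral_of_dominated_convergence' bound ?_ ?_ ?_ ?_
    · exact fun n => ((hsm (n + N)).continuous.measurable.enorm.aemeasurable.mul hW)
    · intro n
      have hn : (φ (n + N)).rOut < δ := hN (n + N) (Nat.le_add_left N n)
      refine Eventually.of_forall fun x => ?_
      by_cases hx : x ∈ cthickening δ K
      · rw [hbound, indicator_of_mem hx]
        refine mul_le_mul_left ?_ _
        rw [← ofReal_norm, Real.norm_eq_abs]
        exact ENNReal.ofReal_le_ofReal (hbd (n + N) x)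
      · change ‖gs (n + N) x‖ₑ * W x ≤ bound x
        rw [hzero (n + N) hn.le x hx, enorm_zero, zero_mul]
        exact zero_le
    · rw [hbound, lintegral_indicator hK'c.measurableSet, lintegral_const_mul'' _ hW.restrict]
      exact ENNReal.mul_ne_top ENNReal.ofReal_ne_top (hWint _ hK'c hδS).ne
    · filter_upwards [hae, hWfin] with x hx hxfin
      have hx' : Tendsto (fun n => gs (n + N) x) atTop (𝓝 (g x)) :=
        (tendsto_add_atTop_iff_nat N).2 hx
      by_cases hxK : x ∈ cthickening δ K
      · have hWx : W x ≠ ∞ := (hxfin hxK).ne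
        have h1 : Tendsto (fun n => ‖gs (n + N) x‖ₑ) atTop (𝓝 ‖g x‖ₑ) :=
          (continuous_enorm.tendsto _).comp hx'
        exact ENNReal.Tendsto.mul_const h1 (Or.inr hWx)
      · have h0 : ∀ n, ‖gs (n + N) x‖ₑ * W x = ‖g x‖ₑ * W x := by
          intro n
          have hn : (φ (n + N)).rOut < δ := hN (n + N) (Nat.le_add_left N n)
          have hgx : g x = 0 := hgK x fun hxK' => hxK (self_subset_cthickening K hxK')
          rw [hzero (n + N) hn.le x hxK, hgx]
        simp_rw [h0]
        exact tendsto_const_nhds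
  -- pass to the limit in the bound for the mollified functions
  have hevb : ∀ᶠ n in atTop,
      ENNReal.ofReal |∫ x in S, E x * gs n x ∂μ| ≤ ∫⁻ x, ‖gs n x‖ₑ * W x ∂μ := by
    filter_upwards [hev] with n hn
    exact h (gs n) (hsm n) (hcs n) (hts n hn.le)
  exact le_of_tendsto_of_tendsto hlim' hlimW hevb

/-! ### The extraction -/

/-- **From test-function pairings to a pointwise bound a.e.** Let `S` be open, `E ∈ L¹(S, μ)`,
`W ≥ 0` a.e.-measurable with `∫_K W < ∞` for every compact `K ⊆ S`, and suppose
`|∫_S E Ψ dμ| ≤ ∫ |Ψ| W dμ` for every smooth compactly supported `Ψ` with `tsupport Ψ ⊆ S`. Then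
`|E| ≤ W` almost everywhere on `S`. [folklore] -/
theorem ae_enorm_le_of_forall_test {S : Set G} (hS : IsOpen S)
    {E : G → ℝ} (hE : IntegrableOn E S μ) {W : G → ℝ≥0∞} (hW : AEMeasurable W μ)
    (hWint : ∀ K : Set G, IsCompact K → K ⊆ S → ∫⁻ x in K, W x ∂μ < ∞)
    (h : ∀ Ψ : G → ℝ, ContDiff ℝ (⊤ : ℕ∞) Ψ → HasCompactSupport Ψ → tsupport Ψ ⊆ S →
      ENNReal.ofReal |∫ x in S, E x * Ψ x ∂μ| ≤ ∫⁻ x, ‖Ψ x‖ₑ * W x ∂μ) :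
    ∀ᵐ x ∂(μ.restrict S), ‖E x‖ₑ ≤ W x := by
  -- measurable modifications
  set E' : G → ℝ := hE.aestronglyMeasurable.mk E with hE'
  have hE'm : StronglyMeasurable E' := hE.aestronglyMeasurable.stronglyMeasurable_mk
  have hEE' : E =ᵐ[μ.restrict S] E' := hE.aestronglyMeasurable.ae_eq_mk
  set W' : G → ℝ≥0∞ := hW.mk W with hW'
  have hW'm : Measurable W' := hW.measurable_mk
  have hWW' : W =ᵐ[μ] W' := hW.ae_eq_mk
  -- it suffices to treat `E'`, `W'`
  suffices H : ∀ᵐ x ∂(μ.restrict S), ‖E' x‖ₑ ≤ W' x by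
    filter_upwards [H, hEE', ae_restrict_of_ae hWW'] with x hx h1 h2
    rwa [h1, h2]
  -- a compact exhaustion of `S`
  obtain ⟨K, hKc, hKS, -, hKcov⟩ := exists_compact_exhaustion_of_isOpen hS
  -- the truncation sets `T k M = K_k ∩ {W' ≤ M} ∩ {W' < |E'|}` are null
  set T : ℕ → ℕ → Set G := fun k M =>
    K k ∩ {x | W' x ≤ (M : ℝ≥0∞)} ∩ {x | W' x < ‖E' x‖ₑ} with hT
  have hTm : ∀ k M, MeasurableSet (T k M) := fun k M =>
    ((hKc k).measurableSet.inter (hW'm measurableSet_Iic)).inter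
      (measurableSet_lt hW'm hE'm.measurable.enorm)
  have hTK : ∀ k M, T k M ⊆ K k := fun k M => inter_subset_left.trans inter_subset_left
  have hTnull : ∀ k M, μ (T k M) = 0 := by
    intro k M
    by_contra hpos
    have hμT : 0 < μ (T k M) := pos_iff_ne_zero.2 hpos
    have hμTfin : μ (T k M) < ∞ := (measure_mono (hTK k M)).trans_lt (hKc k).measure_lt_top
    -- the test function `g = 𝟙_T E'/|E'|`
    set g : G → ℝ := (T k M).indicator fun x => E' x / |E' x| with hg
    have hgm : StronglyMeasurable g :=
      (hE'm.measurable.div (continuous_abs.measurable.comp hE'm.measurable)).stronglyMeasurable.indicator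
        (hTm k M)
    have hg1 : ∀ x, |g x| ≤ 1 := by
      intro x
      by_cases hx : x ∈ T k M
      · rw [hg, indicator_of_mem hx, abs_div, abs_abs]
        by_cases h0 : E' x = 0
        · simp [h0]
        · rw [div_self (abs_ne_zero.2 h0)]
      · rw [hg, indicator_of_notMem hx, abs_zero]; exact zero_le_one
    have hgK : ∀ x, x ∉ K k → g x = 0 := fun x hx => by
      rw [hg, indicator_of_notMem fun h' => hx (hTK k M h')]
    have key := ofReal_abs_setIntegral_mul_le_of_forall_test_weighted hS hE hW hWint h (hKc k)
      (hKS k) hgm hg1 hgK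
    -- `E g = 𝟙_T |E'|` a.e. on `S`, and `|g| W ≤ 𝟙_T W'`
    have hEg : ∀ x, E' x * g x = (T k M).indicator (fun x => |E' x|) x := by
      intro x
      by_cases hx : x ∈ T k M
      · rw [hg, indicator_of_mem hx, indicator_of_mem hx]
        by_cases h0 : E' x = 0
        · simp [h0]
        · rw [mul_div_assoc', div_eq_iff (abs_ne_zero.2 h0), abs_mul_abs_self]
      · rw [hg, indicator_of_notMem hx, indicator_of_notMem hx, mul_zero]
    have hLHS : ∫ x in S, E x * g x ∂μ = ∫ x in T k M, |E' x| ∂μ := by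
      have h1 : ∫ x in S, E x * g x ∂μ = ∫ x in S, E' x * g x ∂μ := by
        refine integral_congr_ae ?_
        filter_upwards [hEE'] with x hx
        rw [hx]
      rw [h1, integral_congr_ae (Eventually.of_forall hEg), integral_indicator (hTm k M),
        Measure.restrict_restrict (hTm k M),
        inter_eq_left.2 ((hTK k M).trans (hKS k))]
    have hRHS : ∫⁻ x, ‖g x‖ₑ * W x ∂μ ≤ ∫⁻ x in T k M, W' x ∂μ := by
      rw [lintegral_congr_ae (hWW'.mono fun x hx => show ‖g x‖ₑ * W x = ‖g x‖ₑ * W' x by rw [hx]),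
        ← lintegral_indicator (hTm k M)]
      refine lintegral_mono fun x => ?_
      by_cases hx : x ∈ T k M
      · rw [indicator_of_mem hx]
        calc ‖g x‖ₑ * W' x ≤ 1 * W' x := by
              refine mul_le_mul_left ?_ _
              rw [← ofReal_norm, Real.norm_eq_abs]
              exact ENNReal.ofReal_le_one.2 (hg1 x)
          _ = W' x := one_mul _
      · rw [hg, indicator_of_notMem hx, indicator_of_notMem hx, enorm_zero, zero_mul]
    -- on `T`: `W' ≤ M`, so the right side is a finite integral of `W'.toReal`
    have hW'T : ∀ x ∈ T k M, W' x ≤ (M : ℝ≥0∞) := fun x hx => hx.1.2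
    have hW'fin : ∫⁻ x in T k M, W' x ∂μ < ∞ := by
      calc ∫⁻ x in T k M, W' x ∂μ ≤ ∫⁻ x in T k M, (M : ℝ≥0∞) ∂μ :=
            setLIntegral_mono' (hTm k M) fun x hx => hW'T x hx
        _ = (M : ℝ≥0∞) * μ (T k M) := setLIntegral_const _ _
        _ < ∞ := ENNReal.mul_lt_top (ENNReal.natCast_lt_top M) hμTfin
    have hW'int : IntegrableOn (fun x => (W' x).toReal) (T k M) μ := by
      refine ⟨hW'm.ennreal_toReal.aestronglyMeasurable, ?_⟩
      rw [hasFiniteIntegral_iff_enorm]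
      calc ∫⁻ x in T k M, ‖(W' x).toReal‖ₑ ∂μ ≤ ∫⁻ x in T k M, W' x ∂μ :=
            lintegral_mono fun x => by rw [Real.enorm_eq_ofReal ENNReal.toReal_nonneg]; exact ENNReal.ofReal_toReal_le
        _ < ∞ := hW'fin
    have hE'int : IntegrableOn (fun x => |E' x|) (T k M) μ := by
      have h1 : IntegrableOn E' S μ := hE.congr hEE'
      exact (h1.mono_set ((hTK k M).trans (hKS k))).abs
    -- the inequality `∫_T |E'| ≤ ∫_T W'.toReal`
    have hineq : ∫ x in T k M, |E' x| ∂μ ≤ ∫ x in T k M, (W' x).toReal ∂μ := by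
      have h1 : ENNReal.ofReal (∫ x in T k M, |E' x| ∂μ) ≤ ∫⁻ x in T k M, W' x ∂μ := by
        have := key
        rw [hLHS, abs_of_nonneg (integral_nonneg fun x => abs_nonneg _)] at this
        exact this.trans hRHS
      have h2 : ∫⁻ x in T k M, W' x ∂μ = ENNReal.ofReal (∫ x in T k M, (W' x).toReal ∂μ) := by
        rw [ofReal_integral_eq_lintegral_ofReal hW'int (Eventually.of_forall fun x => ENNReal.toReal_nonneg)]
        refine lintegral_congr_ae ?_
        refine (ae_restrict_iff' (hTm k M)).2 (Eventually.of_forall fun x hx => ?_)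
        change W' x = ENNReal.ofReal (W' x).toReal
        rw [ENNReal.ofReal_toReal (ne_top_of_le_ne_top (ENNReal.natCast_ne_top M) (hW'T x hx))]
      rw [h2] at h1
      exact (ENNReal.ofReal_le_ofReal_iff (integral_nonneg fun x => ENNReal.toReal_nonneg)).1 h1
    -- but on `T`, `W'.toReal < |E'|` pointwise, and `μ T > 0`
    have hlt : ∫ x in T k M, (W' x).toReal ∂μ < ∫ x in T k M, |E' x| ∂μ := by
      rw [← sub_pos, ← integral_sub hE'int hW'int]
      have hpos_int : 0 < ∫ x in T k M, (|E' x| - (W' x).toReal) ∂μ := by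
        rw [integral_pos_iff_support_of_nonneg_ae (f := fun x => |E' x| - (W' x).toReal) ?_
          (hE'int.sub hW'int)]
        · have hsub : T k M ⊆ support (fun x => |E' x| - (W' x).toReal) ∩ T k M := by
            intro x hx
            refine ⟨?_, hx⟩
            rw [mem_support]
            have hlt' : (W' x).toReal < |E' x| := by
              have h3 : W' x < ‖E' x‖ₑ := hx.2
              have h4 : W' x ≠ ∞ := ne_top_of_le_ne_top (ENNReal.natCast_ne_top M) (hW'T x hx)
              rw [← ofReal_norm, Real.norm_eq_abs, ← ENNReal.ofReal_toReal h4,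
                ENNReal.ofReal_lt_ofReal_iff_of_nonneg ENNReal.toReal_nonneg] at h3
              exact h3
            linarith
          calc 0 < μ (T k M) := hμT
            _ ≤ μ (support (fun x => |E' x| - (W' x).toReal) ∩ T k M) := measure_mono hsub
            _ = (μ.restrict (T k M)) (support fun x => |E' x| - (W' x).toReal) :=
                (Measure.restrict_apply' (hTm k M)).symm
        · refine (ae_restrict_iff' (hTm k M)).2 (Eventually.of_forall fun x hx => ?_)
          have h3 : W' x < ‖E' x‖ₑ := hx.2
          have h4 : W' x ≠ ∞ := ne_top_of_le_ne_top (ENNReal.natCast_ne_top M) (hW'T x hx)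
          rw [← ofReal_norm, Real.norm_eq_abs, ← ENNReal.ofReal_toReal h4,
            ENNReal.ofReal_lt_ofReal_iff_of_nonneg ENNReal.toReal_nonneg] at h3
          simp only [Pi.zero_apply, sub_nonneg]
          exact h3.le
      exact hpos_int
    exact absurd hineq (not_le.2 hlt)
  -- conclusion: off the null sets `T k M`, and in `S`, `‖E'‖ ≤ W'`
  have hnull : μ (⋃ k, ⋃ M, T k M) = 0 :=
    measure_iUnion_null fun k => measure_iUnion_null fun M => hTnull k M
  have hae : ∀ᵐ x ∂μ, x ∉ ⋃ k, ⋃ M, T k M := measure_eq_zero_iff_ae_notMem.1 hnull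
  rw [ae_restrict_iff' hS.measurableSet]
  filter_upwards [hae] with x hx hxS
  by_contra hlt
  push Not at hlt
  obtain ⟨k, hk⟩ := hKcov x hxS
  have hfin : W' x < ∞ := hlt.trans_le le_top |>.trans_le le_top |> fun _ => lt_top_iff_ne_top.2
    (fun h' => by rw [h'] at hlt; exact not_top_lt hlt)
  obtain ⟨M, hM⟩ := ENNReal.exists_nat_gt hfin.ne
  exact hx (mem_iUnion.2 ⟨k, mem_iUnion.2 ⟨M, ⟨⟨hk k le_rfl, hM.le⟩, hlt⟩⟩⟩)

end Literature.Analysis.FunctionSpaces
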